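import Mathlib
import Literature.Analysis.ValidatedNumerics.ConeMonomialLaplacian
import HarnessLib

/-!
# Real Fréchet derivatives of the disk monomials `z^p z̄^q`

Topic `Literature/Analysis/ValidatedNumerics`.  Technical layer for `ConeSeriesRegularity.lean` (the `C²`
regularity of cone-series functions): the disk monomials `M_{p,q}(z) = z^p z̄^q`
(`ConeMonomial.monomial`, `ConeMonomialLaplacian.lean`) as maps `ℂ → ℂ` over the REAL field —

* `lin` — the fixed real-linear map `(α, β) ↦ (h ↦ α h + β h̄)` (`‖lin‖ ≤ 2`), `conjL` = conjugation;
* `monomialFD p q z = lin (p z^{p−1}z̄^q, q z^p z̄^{q−1})` with **`hasFDerivAt_monomial`** and the disk bound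
  `‖monomialFD p q z‖ ≤ 2(p+q)` (`|z| ≤ 1`);
* `monomialFD2 p q z = lin ∘ D(wirt)(z)` with **`hasFDerivAt_monomialFD`** and `‖monomialFD2 p q z‖ ≤ 4(p+q)²`;
* continuity of both (`continuous_monomialFD`, `continuous_monomialFD2`).

## Sources

[ArioliKoch2019] §2 p. 6, sentence after (2.7) (`∂_z`, `∂_z̄` = partial derivatives in the independent variables
`z`, `z̄`; the monomial rule `∂_z M = p z^{p−1}z̄^q`, `∂_z̄ M = q z^p z̄^{q−1}` is its elementary consequence —
folklore).  The disk bounds `2(p+q)`, `4(p+q)²` and the continuity statements are elementary (folklore) facts behind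
the termwise differentiation of §3 Lemma 3.1, p. 8 (the `ρ > 1` regularity statement they serve in
`ConeSeriesRegularity.lean`); they are NOT printed there.  Monomial version.

## What is NOT covered

Series (next file); float model.

## Provenance

AI-produced formalisation (cell certnum, seat certnum-ode-2, 2026-08-27).
-/

set_option autoImplicit false

open scoped BigOperators Topology
open Complex Filter Set Metric InnerProductSpace
open scoped Laplacian

noncomputable section

namespace Literature.Analysis.ValidatedNumerics

namespace ConeEval

open ConeMonomial

/-! ### §1. `ℝ`-Fréchet derivatives of the disk monomials -/

/-- Complex conjugation as a real-linear map (Mathlib's `conjCLE`). [folklore] -/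
def conjL : ℂ →L[ℝ] ℂ := (Complex.conjCLE : ℂ ≃L[ℝ] ℂ)

/-- [folklore] -/
@[simp] private theorem conjL_apply (h : ℂ) : conjL h = starRingEnd ℂ h := rfl

/-- The fixed real-linear map `(α, β) ↦ (h ↦ α h + β h̄)` packaging the two Wirtinger coefficients into an
`ℝ`-linear endomorphism of `ℂ`. [cite: ArioliKoch2019, §2 p. 6, sentence after (2.7) (∂_z, ∂_z̄ = partial derivatives in the independent variables z, z̄; monomial rule = its elementary consequence — folklore)] -/
def lin : ℂ × ℂ →L[ℝ] (ℂ →L[ℝ] ℂ) :=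
  (ContinuousLinearMap.fst ℝ ℂ ℂ).smulRight (1 : ℂ →L[ℝ] ℂ)
    + (ContinuousLinearMap.snd ℝ ℂ ℂ).smulRight conjL

/-- [folklore] -/
@[simp] private theorem lin_apply (a : ℂ × ℂ) (h : ℂ) : lin a h = a.1 * h + a.2 * starRingEnd ℂ h := by
  simp [lin, conjL]

/-- `‖lin (α,β)‖ ≤ 2 ‖(α,β)‖` (each of the two pieces has norm `≤ 1`). [folklore] -/
private theorem norm_lin_apply_le (a : ℂ × ℂ) : ‖lin a‖ ≤ 2 * ‖a‖ := by
  refine ContinuousLinearMap.opNorm_le_bound _ (by positivity) fun h => ?_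
  rw [lin_apply]
  have h1 : ‖a.1‖ ≤ ‖a‖ := norm_fst_le a
  have h2 : ‖a.2‖ ≤ ‖a‖ := norm_snd_le a
  calc ‖a.1 * h + a.2 * starRingEnd ℂ h‖ ≤ ‖a.1 * h‖ + ‖a.2 * starRingEnd ℂ h‖ := norm_add_le _ _
    _ = ‖a.1‖ * ‖h‖ + ‖a.2‖ * ‖h‖ := by rw [norm_mul, norm_mul, Complex.norm_conj]
    _ ≤ ‖a‖ * ‖h‖ + ‖a‖ * ‖h‖ := by gcongr
    _ = 2 * ‖a‖ * ‖h‖ := by ring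

/-- `‖lin‖ ≤ 2`. [folklore] -/
private theorem norm_lin_le : ‖lin‖ ≤ 2 :=
  ContinuousLinearMap.opNorm_le_bound _ (by norm_num) fun a => norm_lin_apply_le a

/-- The Wirtinger coefficients of `M_{p,q}`: `(p z^{p−1}z̄^q, q z^p z̄^{q−1})`.
[cite: ArioliKoch2019, §2 p. 6, sentence after (2.7) (∂_z, ∂_z̄ = partial derivatives in the independent variables z, z̄; monomial rule = its elementary consequence — folklore)] -/
def wirt (p q : ℕ) (z : ℂ) : ℂ × ℂ := ((p : ℂ) * monomial (p - 1) q z, (q : ℂ) * monomial p (q - 1) z)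

/-- The `ℝ`-Fréchet derivative of `M_{p,q}(z) = z^p z̄^q`: `h ↦ p z^{p−1}z̄^q h + q z^p z̄^{q−1} h̄`.
[cite: ArioliKoch2019, §2 p. 6, sentence after (2.7) (∂_z, ∂_z̄ = partial derivatives in the independent variables z, z̄; monomial rule = its elementary consequence — folklore)] -/
def monomialFD (p q : ℕ) (z : ℂ) : ℂ →L[ℝ] ℂ := lin (wirt p q z)

/-- [cite: ArioliKoch2019, §2 p. 6, sentence after (2.7) (∂_z, ∂_z̄ = partial derivatives in the independent variables z, z̄; monomial rule = its elementary consequence — folklore)] -/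
theorem monomialFD_apply (p q : ℕ) (z h : ℂ) :
    monomialFD p q z h = (p : ℂ) * monomial (p - 1) q z * h + (q : ℂ) * monomial p (q - 1) z * starRingEnd ℂ h := by
  simp [monomialFD, wirt]

/-- [folklore] -/
private theorem hasFDerivAt_zpow' (p : ℕ) (z : ℂ) :
    HasFDerivAt (fun w : ℂ => w ^ p) (((p : ℂ) * z ^ (p - 1)) • (1 : ℂ →L[ℝ] ℂ)) z := by
  have h := ((hasDerivAt_pow p z).hasFDerivAt).restrictScalars ℝ
  refine h.congr_fderiv ?_
  ext w
  simp [mul_comm]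

/-- [folklore] -/
private theorem hasFDerivAt_conj_pow (q : ℕ) (z : ℂ) :
    HasFDerivAt (fun w : ℂ => (starRingEnd ℂ w) ^ q) (((q : ℂ) * (starRingEnd ℂ z) ^ (q - 1)) • conjL) z := by
  have hc : HasFDerivAt (fun w : ℂ => starRingEnd ℂ w) conjL z :=
    (Complex.conjCLE : ℂ ≃L[ℝ] ℂ).hasFDerivAt
  have h := hc.pow q
  refine h.congr_fderiv ?_
  ext w
  simp only [_root_.smul_apply, conjL_apply, smul_eq_mul, nsmul_eq_mul]

/-- **`D M_{p,q}(z) = monomialFD p q z`** (product rule on `z^p · z̄^q`).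
[cite: ArioliKoch2019, §2 p. 6, sentence after (2.7) (∂_z, ∂_z̄ = partial derivatives in the independent variables z, z̄;
the monomial rule ∂_z M = p z^{p−1}z̄^q, ∂_z̄ M = q z^p z̄^{q−1} = its elementary consequence — folklore)] -/
theorem hasFDerivAt_monomial (p q : ℕ) (z : ℂ) : HasFDerivAt (monomial p q) (monomialFD p q z) z := by
  have h := (hasFDerivAt_zpow' p z).mul (hasFDerivAt_conj_pow q z)
  have e : monomial p q = fun w : ℂ => w ^ p * (starRingEnd ℂ w) ^ q := rfl
  rw [e]
  refine h.congr_fderiv ?_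
  ext w
  rw [monomialFD_apply]
  simp only [_root_.add_apply, _root_.smul_apply, one_apply_eq_self, conjL_apply, smul_eq_mul,
    monomial]
  ring

/-- **Disk bound `‖D M_{p,q}(z)‖ ≤ 2(p+q)`** for `|z| ≤ 1`. [folklore] (elementary disk bounds behind the
termwise differentiation of §3 Lemma 3.1); context [cite: ArioliKoch2019, §3 Lemma 3.1, p. 8 (the ρ > 1 regularity
statement this elementary bound serves in ConeSeriesRegularity.lean; the bound itself is NOT printed there)] -/
theorem norm_monomialFD_le (p q : ℕ) {z : ℂ} (hz : ‖z‖ ≤ 1) : ‖monomialFD p q z‖ ≤ 2 * ((p : ℝ) + q) := by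
  have hm : ∀ a b : ℕ, ‖monomial a b z‖ ≤ 1 := by
    intro a b
    rw [monomial, norm_mul, norm_pow, norm_pow, Complex.norm_conj]
    calc ‖z‖ ^ a * ‖z‖ ^ b ≤ 1 * 1 :=
          mul_le_mul (pow_le_one₀ (norm_nonneg _) hz) (pow_le_one₀ (norm_nonneg _) hz)
            (pow_nonneg (norm_nonneg _) _) zero_le_one
      _ = 1 := one_mul 1
  have hw : ‖wirt p q z‖ ≤ (p : ℝ) + q := by
    refine (Prod.norm_def _).le.trans (max_le ?_ ?_)
    · simp only [wirt]
      rw [norm_mul, Complex.norm_natCast]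
      calc (p : ℝ) * ‖monomial (p - 1) q z‖ ≤ p * 1 := mul_le_mul_of_nonneg_left (hm _ _) (Nat.cast_nonneg p)
        _ ≤ (p : ℝ) + q := by rw [mul_one]; exact le_add_of_nonneg_right (Nat.cast_nonneg q)
    · simp only [wirt]
      rw [norm_mul, Complex.norm_natCast]
      calc (q : ℝ) * ‖monomial p (q - 1) z‖ ≤ q * 1 := mul_le_mul_of_nonneg_left (hm _ _) (Nat.cast_nonneg q)
        _ ≤ (p : ℝ) + q := by rw [mul_one]; exact le_add_of_nonneg_left (Nat.cast_nonneg p)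
  calc ‖monomialFD p q z‖ = ‖lin (wirt p q z)‖ := rfl
    _ ≤ 2 * ‖wirt p q z‖ := norm_lin_apply_le _
    _ ≤ 2 * ((p : ℝ) + q) := by gcongr

/-- The derivative of the Wirtinger coefficient map: `D wirt_{p,q}(z) = (p D M_{p−1,q}(z), q D M_{p,q−1}(z))`.
[cite: ArioliKoch2019, §2 p. 6, sentence after (2.7) (∂_z, ∂_z̄ = partial derivatives in the independent variables z, z̄; monomial rule = its elementary consequence — folklore)] -/
def wirtFD (p q : ℕ) (z : ℂ) : ℂ →L[ℝ] (ℂ × ℂ) :=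
  ((p : ℂ) • monomialFD (p - 1) q z).prod ((q : ℂ) • monomialFD p (q - 1) z)

/-- [cite: ArioliKoch2019, §2 p. 6, sentence after (2.7) (∂_z, ∂_z̄ = partial derivatives in the independent variables z, z̄; monomial rule = its elementary consequence — folklore)] -/
theorem hasFDerivAt_wirt (p q : ℕ) (z : ℂ) : HasFDerivAt (wirt p q) (wirtFD p q z) z := by
  unfold wirt wirtFD
  exact ((hasFDerivAt_monomial (p - 1) q z).const_mul (p : ℂ)).prodMk
    ((hasFDerivAt_monomial p (q - 1) z).const_mul (q : ℂ))

/-- The second `ℝ`-Fréchet derivative of `M_{p,q}`: `lin ∘ D wirt_{p,q}(z)`.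
[cite: ArioliKoch2019, §2 p. 6, sentence after (2.7) (∂_z, ∂_z̄ = partial derivatives in the independent variables z, z̄; monomial rule = its elementary consequence — folklore)] -/
def monomialFD2 (p q : ℕ) (z : ℂ) : ℂ →L[ℝ] (ℂ →L[ℝ] ℂ) := lin.comp (wirtFD p q z)

/-- **`D(D M_{p,q})(z) = monomialFD2 p q z`** (chain rule through the fixed linear map `lin`).
[cite: ArioliKoch2019, §2 p. 6, sentence after (2.7) (∂_z, ∂_z̄ = partial derivatives in the independent variables z, z̄; monomial rule = its elementary consequence — folklore)] -/
theorem hasFDerivAt_monomialFD (p q : ℕ) (z : ℂ) : HasFDerivAt (monomialFD p q) (monomialFD2 p q z) z := by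
  have e : monomialFD p q = fun w => lin (wirt p q w) := rfl
  rw [e]
  exact lin.hasFDerivAt.comp z (hasFDerivAt_wirt p q z)

/-- **Disk bound `‖D² M_{p,q}(z)‖ ≤ 4(p+q)²`** for `|z| ≤ 1`. [folklore] (elementary disk bounds behind the
termwise differentiation of §3 Lemma 3.1); context [cite: ArioliKoch2019, §3 Lemma 3.1, p. 8 (the ρ > 1 regularity
statement this elementary bound serves in ConeSeriesRegularity.lean; the bound itself is NOT printed there)] -/
theorem norm_monomialFD2_le (p q : ℕ) {z : ℂ} (hz : ‖z‖ ≤ 1) :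
    ‖monomialFD2 p q z‖ ≤ 4 * ((p : ℝ) + q) ^ 2 := by
  have hp1 : ((p - 1 : ℕ) : ℝ) ≤ p := by exact_mod_cast Nat.sub_le p 1
  have hq1 : ((q - 1 : ℕ) : ℝ) ≤ q := by exact_mod_cast Nat.sub_le q 1
  have hW : ‖wirtFD p q z‖ ≤ 2 * ((p : ℝ) + q) ^ 2 := by
    have hp0 : (0 : ℝ) ≤ p := Nat.cast_nonneg p
    have hq0 : (0 : ℝ) ≤ q := Nat.cast_nonneg q
    have hD1 := norm_monomialFD_le (p - 1) q hz
    have hD2 := norm_monomialFD_le p (q - 1) hz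
    refine ContinuousLinearMap.opNorm_le_bound _ (by positivity) fun h => ?_
    unfold wirtFD
    rw [ContinuousLinearMap.prod_apply, Prod.norm_def]
    refine max_le ?_ ?_
    · simp only
      rw [_root_.smul_apply, norm_smul, Complex.norm_natCast]
      calc (p : ℝ) * ‖monomialFD (p - 1) q z h‖ ≤ p * (‖monomialFD (p - 1) q z‖ * ‖h‖) :=
            mul_le_mul_of_nonneg_left (ContinuousLinearMap.le_opNorm _ _) hp0
        _ ≤ p * (2 * (((p - 1 : ℕ) : ℝ) + q) * ‖h‖) := by
            gcongr
        _ = (p * (2 * (((p - 1 : ℕ) : ℝ) + q))) * ‖h‖ := by ring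
        _ ≤ 2 * ((p : ℝ) + q) ^ 2 * ‖h‖ := by
            refine mul_le_mul_of_nonneg_right ?_ (norm_nonneg h)
            nlinarith
    · simp only
      rw [_root_.smul_apply, norm_smul, Complex.norm_natCast]
      calc (q : ℝ) * ‖monomialFD p (q - 1) z h‖ ≤ q * (‖monomialFD p (q - 1) z‖ * ‖h‖) :=
            mul_le_mul_of_nonneg_left (ContinuousLinearMap.le_opNorm _ _) hq0
        _ ≤ q * (2 * ((p : ℝ) + ((q - 1 : ℕ) : ℝ)) * ‖h‖) := by
            gcongr
        _ = (q * (2 * ((p : ℝ) + ((q - 1 : ℕ) : ℝ)))) * ‖h‖ := by ring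
        _ ≤ 2 * ((p : ℝ) + q) ^ 2 * ‖h‖ := by
            refine mul_le_mul_of_nonneg_right ?_ (norm_nonneg h)
            nlinarith
  calc ‖monomialFD2 p q z‖ ≤ ‖lin‖ * ‖wirtFD p q z‖ := ContinuousLinearMap.opNorm_comp_le _ _
    _ ≤ 2 * (2 * ((p : ℝ) + q) ^ 2) := mul_le_mul norm_lin_le hW (norm_nonneg _) (by norm_num)
    _ = 4 * ((p : ℝ) + q) ^ 2 := by ring

/-- `D M_{p,q}` is continuous (it is differentiable). [folklore] (elementary continuity statements behind the
termwise differentiation of §3 Lemma 3.1); context [cite: ArioliKoch2019, §3 Lemma 3.1, p. 8 (the ρ > 1 regularity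
statement this serves in ConeSeriesRegularity.lean; the continuity statement itself is NOT printed there)] -/
theorem continuous_monomialFD (p q : ℕ) : Continuous (monomialFD p q) :=
  continuous_iff_continuousAt.2 fun z => (hasFDerivAt_monomialFD p q z).continuousAt

/-- `D² M_{p,q}` is continuous. [folklore] (elementary continuity statements behind the termwise differentiation
of §3 Lemma 3.1); context [cite: ArioliKoch2019, §3 Lemma 3.1, p. 8 (the ρ > 1 regularity statement this serves in
ConeSeriesRegularity.lean; the continuity statement itself is NOT printed there)] -/
theorem continuous_monomialFD2 (p q : ℕ) : Continuous (monomialFD2 p q) := by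
  have hW : Continuous (wirtFD p q) := by
    unfold wirtFD
    exact (ContinuousLinearMap.prodₗᵢ ℝ :
        ((ℂ →L[ℝ] ℂ) × (ℂ →L[ℝ] ℂ)) ≃ₗᵢ[ℝ] (ℂ →L[ℝ] ℂ × ℂ)).continuous.comp
      (((continuous_monomialFD (p - 1) q).const_smul (p : ℂ)).prodMk
        ((continuous_monomialFD p (q - 1)).const_smul (q : ℂ)))
  unfold monomialFD2
  exact continuous_const.clm_comp hW

end ConeEval

end Literature.Analysis.ValidatedNumerics
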